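import Summits.BirchSwinnertonDyer.BirchSwinnertonDyer.Theorems.GenusKolyvaginAtTwoMinimalTwinBSDTwoTwoAdic
import Literature.NumberTheory.EllipticCurves.PAdicBSDGoodOrdinaryRankOne
import HarnessLib

/-!
# Crux `MinimalTwinBSDTwo` (route `GenusKolyvaginAtTwo`, item stmt-BirchSwinnertonDyer-22985): BRIDGE 5 with its
# PRINT conjunct discharged by name — on good-ordinary-at-`2` curves of analytic rank one, K2-G′v = Disegni 2020 ∧ Reg₂ ≠ 0

Cell `bsd-f1-sign2`, seat `bsd-line-gk2-p3` g9 (sequel to this lineage's g6 file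
`…MinimalTwinBSDTwoTwoAdic.lean`, p597746/p599373/p600245). g6's §6 theorem
`twoAdicShaAnTransferRankOneAt_of_exact` unbundled the cell's per-curve statement K2-G′v-At(W)
(`Summit.BirchSwinnertonDyer.Rank1Residual.F1Sign2.TwoAdicShaAnTransferRankOneAt W`) into Schneider's
non-degeneracy at `2` (`Reg₂(D) ≠ 0` for the canonical `σ²`-datum — OPEN, the cell's K2-S₂) and an EXACT
`#Ш_an`-identity `hEx` of Disegni's shape, displayed as a hypothesis. The typer -ty g7 has since vendored that
identity as the named fact `Literature.NumberTheory.EllipticCurves.Disegni2020.padicBSD_goodOrd_rankOne`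
(p606485; Disegni, Kyoto J. Math. 60 (2020) Thm. 1 = Thm. 4 first bullet, IN PRINT at every good ordinary prime
INCLUDING `p = 2`, audit REF2-PLACEMENT-v17 §1 (A); one flagged rider: the `σ²`-receptacle at `2` carries the
Mazur–Tate 1991 height identification, cite-only). This file performs the composition BY NAME:

* §1 `twoAdicShaAnTransferRankOneAt_of_disegni` — K2-G′v-At(W) from the Disegni fact and `Reg₂ ≠ 0` alone;
* §2 `bsdp_two_of_twoAdicVal_of_disegni` — on a good-ordinary-at-`2` curve of analytic rank one, Miller's `BSD(W,2)`
  from K2-Gv-At(W) (the `#Ш[2^∞]` leading-term norm identity, OPEN = IMC₂-with-leading-term) ∧ `Reg₂ ≠ 0` (OPEN) ∧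
  FOUR PUBLISHED facts (GZK, Mazur–Tate `σ²` at `2`, modularity as parametrisation data, Disegni 2020);
* §3 `minimalTwinBSDTwo_of_twoAdicVal_of_regulator_of_offOrdinary` — crux #6 `MinimalTwinBSDTwo` BY NAME from the
  four facts, the pair (K2-Gv-At, Reg₂ ≠ 0) on every ORDINARY member of its class, and `BSDp W 2` displayed on the
  non-ordinary members: after this file the open content of crux #6 on good-ordinary cells is EXACTLY
  «K2-Gv ∧ Reg₂ ≠ 0» plus print.

HONEST FRAMING. Every theorem is CONDITIONAL on displayed hypotheses (four published named facts + the cell's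
conjecture-grade per-curve statements); nothing here attacks the crux, closes an item, or proves BSD.
References: [Disegni2020] Thm. 1, Thm. 4 (first bullet), Prop. 2; [Miller2011LMS] Def. 1.1;
[MazurTateTeitelbaum1986Invent] §II; Mazur–Tate 1991 (the `σ`-function); Gross–Zagier 1986 / Kolyvagin 1990 (GZK).
-/

set_option autoImplicit false
set_option linter.dupNamespace false -- `Summit.BirchSwinnertonDyer.BirchSwinnertonDyer.…` is the tree's layout (D-0017)

noncomputable section

open scoped Classical

namespace Summit.BirchSwinnertonDyer.BirchSwinnertonDyer.Theorems.MinimalTwinBSDTwo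

open WeierstrassCurve WeierstrassCurve.PAdicHeightData Literature.NumberTheory.EllipticCurves
  Literature.NumberTheory.EllipticCurves.ModularForms
open Summit.BirchSwinnertonDyer.Rank1Residual.F1Sign2
open Summit.BirchSwinnertonDyer.BirchSwinnertonDyer.Theses

/-! ## §1 K2-G′v-At(W) at `2` = Disegni 2020 (print) ∧ `Reg₂ ≠ 0` -/

/-- **K2-G′v at a good ordinary `2` from print and Schneider's non-degeneracy.** For a globally minimal `W/ℚ`:
Disegni 2020 Thm. 1 (named fact `Disegni2020.padicBSD_goodOrd_rankOne`, every ordinary prime incl. `2`) and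
`Reg₂(D) ≠ 0` for the canonical `σ²`-datum give the cell's per-curve K2-G′v-At(W)
(`TwoAdicShaAnTransferRankOneAt W`), by g6's `twoAdicShaAnTransferRankOneAt_of_exact`. CONDITIONAL on the
named fact; closes nothing. [cite: Disegni2020, Thm. 1 = Thm. 4 (first bullet)] -/
theorem twoAdicShaAnTransferRankOneAt_of_disegni (hDis : Disegni2020.padicBSD_goodOrd_rankOne)
    (W : WeierstrassCurve ℚ) [W.IsElliptic] [W.IsGloballyMinimal]
    (hReg : ∀ D : PAdicHeightData W 2, D.IsCanonicalSq → padicRegulator D ≠ 0) :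
    TwoAdicShaAnTransferRankOneAt W :=
  twoAdicShaAnTransferRankOneAt_of_exact W hReg fun hord har ↦ hDis W 2 hord har

/-! ## §2 `BSD(W,2)` on a good-ordinary rank-one curve: K2-Gv ∧ Reg₂ ≠ 0 ∧ four published facts -/

/-- **`BSD(W,2)` at a good ordinary `2` in analytic rank one from K2-Gv-At(W), `Reg₂ ≠ 0` and FOUR published
facts** (GZK `hGZK`, Mazur–Tate `σ²` at `2` `hMT`, modularity as parametrisation data `hMod`, Disegni 2020 `hDis`):
g6's `bsdp_two_of_twoAdicVal_of_exact` with its displayed `hEx` discharged by the Disegni fact. So the open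
content of `BSD(W,2)` on such a curve is «K2-Gv-At(W) ∧ Reg₂ ≠ 0». CONDITIONAL; closes nothing.
[cite: Disegni2020, Thm. 1] [cite: Miller2011LMS, Def. 1.1] -/
theorem bsdp_two_of_twoAdicVal_of_disegni
    (hGZK : rank_eq_analyticRank_of_analyticRank_le_one)
    (hMT : mazurTate_sigmaSq_existsUnique_two)
    (hMod : nonempty_modularParametrizationData)
    (hDis : Disegni2020.padicBSD_goodOrd_rankOne)
    (W : WeierstrassCurve ℚ) [W.IsElliptic] [W.IsGloballyMinimal]
    (hord : IsOrdinaryAt W 2) (har : W.analyticRank = 1)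
    (hGv : TwoAdicBSDValRankOneAt W)
    (hReg : ∀ D : PAdicHeightData W 2, D.IsCanonicalSq → padicRegulator D ≠ 0) : BSDp W 2 :=
  bsdp_two_of_twoAdicAt hGZK hMT hMod W hord har hGv (twoAdicShaAnTransferRankOneAt_of_disegni hDis W hReg)

/-! ## §3 Crux #6 by name: ordinary cells need K2-Gv ∧ Reg₂ ≠ 0, the rest is print or displayed -/

/-- **Crux #6 `MinimalTwinBSDTwo` BY NAME** from: the four published facts; on every ORDINARY-at-`2` member of its
class (non-CM, `r_an = 1`, `#Sel₂ = 2`) the pair K2-Gv-At(W) ∧ `Reg₂ ≠ 0` (`hOrd`, the cell's OPEN content —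
IMC₂-with-leading-term and Schneider's conjecture at `2`); and `BSDp W 2` displayed on the NON-ordinary members
(`hOff`: supersingular, multiplicative or additive at `2`). Compared with g6's
`minimalTwinBSDTwo_of_twoAdicAt_of_offOrdinary`, the K2-G′v conjunct is gone — replaced by Disegni's theorem and
`Reg₂ ≠ 0`. CONDITIONAL; closes nothing. [cite: Disegni2020, Thm. 1] [cite: Miller2011LMS, Def. 1.1] -/
theorem minimalTwinBSDTwo_of_twoAdicVal_of_regulator_of_offOrdinary
    (hGZK : rank_eq_analyticRank_of_analyticRank_le_one)
    (hMT : mazurTate_sigmaSq_existsUnique_two)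
    (hMod : nonempty_modularParametrizationData)
    (hDis : Disegni2020.padicBSD_goodOrd_rankOne)
    (hOrd : ∀ (W : WeierstrassCurve ℚ) [W.IsElliptic] [W.IsGloballyMinimal], ¬ W.HasCM →
      W.analyticRank = 1 → Nat.card (W.selmerGroup 2) = 2 → IsOrdinaryAt W 2 →
      TwoAdicBSDValRankOneAt W ∧ ∀ D : PAdicHeightData W 2, D.IsCanonicalSq → padicRegulator D ≠ 0)
    (hOff : ∀ (W : WeierstrassCurve ℚ) [W.IsElliptic] [W.IsGloballyMinimal], ¬ W.HasCM →
      W.analyticRank = 1 → Nat.card (W.selmerGroup 2) = 2 → ¬ IsOrdinaryAt W 2 → BSDp W 2) :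
    GenusKolyvaginAtTwo.MinimalTwinBSDTwo := by
  intro W _ _ hcm har hSel
  by_cases hord : IsOrdinaryAt W 2
  · obtain ⟨hGv, hReg⟩ := hOrd W hcm har hSel hord
    exact bsdp_two_of_twoAdicVal_of_disegni hGZK hMT hMod hDis W hord har hGv hReg
  · exact hOff W hcm har hSel hord

/-- **The ordinary slice of crux #6 on the crux's own binders, print discharged.** Non-CM `W`, `r_an(W) = 1`,
`#Sel₂(W) = 2` (both idle), `W` good ordinary at `2`, K2-Gv-At(W), `Reg₂ ≠ 0` ⟹ `BSDp W 2`, granted the four facts.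
This is the form the route's `closes` consumes for the twin `Wd` of the supply crux whenever `Wd` is ordinary at
`2` (g6's `OrdinaryTwistAtTwo`: ordinarity at `2` is stable under the odd-`d_K` twist). [cite: Disegni2020, Thm. 1]
[cite: Miller2011LMS, Def. 1.1] -/
theorem minimalTwinBSDTwo_ordSlice_of_twoAdicVal_of_regulator
    (hGZK : rank_eq_analyticRank_of_analyticRank_le_one)
    (hMT : mazurTate_sigmaSq_existsUnique_two)
    (hMod : nonempty_modularParametrizationData)
    (hDis : Disegni2020.padicBSD_goodOrd_rankOne) :
    ∀ (W : WeierstrassCurve ℚ) [W.IsElliptic] [W.IsGloballyMinimal], ¬ W.HasCM → W.analyticRank = 1 →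
      Nat.card (W.selmerGroup 2) = 2 → IsOrdinaryAt W 2 → TwoAdicBSDValRankOneAt W →
      (∀ D : PAdicHeightData W 2, D.IsCanonicalSq → padicRegulator D ≠ 0) → BSDp W 2 :=
  fun W _ _ _ har _ hord hGv hReg ↦ bsdp_two_of_twoAdicVal_of_disegni hGZK hMT hMod hDis W hord har hGv hReg

end Summit.BirchSwinnertonDyer.BirchSwinnertonDyer.Theorems.MinimalTwinBSDTwo

end
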